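import Mathlib
import Summits.MatrixMultiplication.Statement
import Literature.Computability.AlgebraicComplexity.FlatteningBound
import Literature.Computability.AlgebraicComplexity.NonscalarComputation
import Literature.Computability.AlgebraicComplexity.NonscalarBilinearRank
import Summits.MatrixMultiplication.MatrixMultiplication.Theorems.GraphEquationsSystems
import Summits.MatrixMultiplication.MatrixMultiplication.Theorems.GraphEquationsGenerators
import Summits.MatrixMultiplication.MatrixMultiplication.Theorems.GraphEquationsKernel
import Summits.MatrixMultiplication.MatrixMultiplication.Theorems.GraphEquationsCostRank
import Summits.MatrixMultiplication.MatrixMultiplication.Theorems.GraphEquationsWeightedTruncation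

/-!
# The initial-form cost–rank inequality and the piece `H_init` (`GraphEquations`, kernel M8)

Decomp-mm node «GraphEquations» (lens 5); attacked leaf `MultiplicityReduction` = `H_mult` of
`Theses/GraphEquations.lean`.  Target of the node, VERBATIM: `_root_.MatrixMultiplication`.

**The move (higher-order truncation).**  The landed reduced branch (`GraphEquationsCostRank`,
`GraphEquationsCoeffIdentity`) truncates an equation system at a REDUCED point `x ∈ W_n` to
SECOND order: the linear `C`-coefficients of the shifted tests form the full-rank Jacobian
`J_C(x)` and the `A ⊗ B`-bilinear coefficients are `−(id ⊗ id ⊗ J_C(x))⟨n,n,n⟩`.  Here the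
truncation is carried to ARBITRARY weighted order `K` (weights `w(a) = w(b) = 1`, `w(c) = 2`,
under which the generators `f_q = c_q − Σ_k a_{q₁k} b_{kq₂}` of the ideal of the graph are
weighted homogeneous of degree `2` and invariant under the shift `θ_x`, `x ∈ W_n`):

* `coeff_ab_aeval_psi` — for EVERY `P ∈ ℂ[F_q : q ∈ n × n]` and `γ ∈ ℂ^{n×n}`, substituting
  `F_q ↦ γ_q − Σ_k a_{q₁k} b_{kq₂}` (`psi γ`) gives
  `coeff_{a_ij b_j'l}(P(ψ_γ)) = −[j = j'] · (∂P/∂F_il)(γ)`;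
* `tensorRank_le_of_initialForms` (SYSTEM-FREE CORE) — if `T` polynomials lie in the cost-free
  span of one nonscalar sequence of length `≤ N`, and their weighted components of orders
  `m_o ≤ K` are polynomials `P_o(f)` in the generators whose GRADIENT MATRIX
  `G(γ)_{o,q} = (∂P_o/∂F_q)(γ)` has rank `n²` at some `γ`, then `R(⟨n,n,n⟩) ≤ 2·K²·N`
  (weighted truncation `exists_weightedTruncation` → free substitution `c ↦ γ` → BCS (14.1)
  triads → the coefficient identity → a left inverse of `G(γ)`);
* `tensorRank_le_of_initNondegAt` — the EqSystem version after the free shift `θ_x`;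
* the piece **`H_init`** = `InitialFormReduction` («cheap correct systems can be made cheap,
  correct and INITIAL-FORM NONDEGENERATE of bounded order») with
  `omega_le_of_eqAdmissibleInit` and `multiplicityReduction_of_initialFormReduction :
  H_init → H_mult` (density of `ℝ` + `eqAdmissibleRed_of_omega_lt`).

Why this re-types the attack on `H_mult`: «reduced at `x`» is the case `K = 2`, `P_o` LINEAR,
`G = J_C(x)`; but e.g. the everywhere NON-reduced system with tests `f_q²` (Jacobian `≡ 0` on
`W_n`) is initial-form nondegenerate with `K = 4`, `P_q = F_q²`, `G(γ) = diag(2γ)`.  The open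
core shrinks from «remove multiplicity» to «make the bounded-order initial forms algebraically
nondegenerate».  No `sorry`; nothing here is asserted about the open pieces.

Sources: [Strassen1973] (truncation); [BurgisserClausenShokrollahi1997, §4.1 Rem. (4.3), Thm.
(7.1), Prop. (14.1), (14.8), Problem 16.3]; [Kunnemann2018 arXiv:1806.09189] (verification
status).
-/

set_option linter.dupNamespace false

noncomputable section

open scoped BigOperators

namespace Summit.MatrixMultiplication.MatrixMultiplication.Theorems.GraphEquations

open MvPolynomial
open Literature.Computability.AlgebraicComplexity
open Literature.Computability.AlgebraicComplexity.ArithCircuit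

variable {n : ℕ}

/-! ## Weights, generators, substitutions -/

/-- The weight `w(a) = w(b) = 1`, `w(c) = 2`. -/
def gw (n : ℕ) : GraphVars n → ℕ := fun v => Sum.elim (fun _ => 1) (fun _ => 2) v

/-- All weights are nonzero. -/
theorem gw_ne_zero (v : GraphVars n) : gw n v ≠ 0 := by
  rcases v with v | v <;> simp [gw]

/-- The generator `f_q = c_q − Σ_k a_{q₁ k} b_{k q₂}` of the ideal of the graph `W_n`. -/
def generator (n : ℕ) (q : Fin n × Fin n) : MvPolynomial (GraphVars n) ℂ :=
  X (Sum.inr q) - ∑ k : Fin n, X (Sum.inl (Sum.inl (q.1, k))) * X (Sum.inl (Sum.inr (k, q.2)))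

/-- The substitution `ψ_γ : F_q ↦ γ_q − Σ_k a_{q₁ k} b_{k q₂}` (the generator with `c ↦ γ`). -/
def psi (γ : Fin n × Fin n → ℂ) (q : Fin n × Fin n) : MvPolynomial (GraphVars n) ℂ :=
  C (γ q) - ∑ k : Fin n, X (Sum.inl (Sum.inl (q.1, k))) * X (Sum.inl (Sum.inr (k, q.2)))

/-- The AFFINE substitution `θ_γ`: `a, b ↦ a, b`, `c_q ↦ γ_q` (cost-free). -/
def constC (γ : Fin n × Fin n → ℂ) : GraphVars n → MvPolynomial (GraphVars n) ℂ
  | Sum.inl v => X (Sum.inl v)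
  | Sum.inr q => C (γ q)

/-- `θ_γ` is cost-free given nothing. -/
theorem constC_mem_freeSpan (γ : Fin n × Fin n → ℂ) (v : GraphVars n) :
    constC γ v ∈ freeSpan {q | q ∈ ([] : List (MvPolynomial (GraphVars n) ℂ))} := by
  rcases v with v | q
  · exact X_mem_freeSpan _ _
  · exact C_mem_freeSpan _ _

/-- `θ_γ(f_q) = ψ_γ(F_q)`. -/
theorem aeval_constC_generator (γ : Fin n × Fin n → ℂ) (q : Fin n × Fin n) :
    aeval (constC γ) (generator n q) = psi γ q := by
  simp [generator, psi, constC, map_sum]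

/-- `θ_γ ∘ (F ↦ f) = ψ_γ` on `ℂ[F]`. -/
theorem aeval_constC_aeval_generator (γ : Fin n × Fin n → ℂ)
    (P : MvPolynomial (Fin n × Fin n) ℂ) :
    aeval (constC γ) (aeval (generator n) P) = aeval (psi γ) P := by
  induction P using MvPolynomial.induction_on with
  | C a => simp
  | add p q hp hq => simp only [map_add, hp, hq]
  | mul_X p q h => simp only [map_mul, aeval_X, h, aeval_constC_generator]

/-- The GRADIENT MATRIX of a family `P_o ∈ ℂ[F]` at `γ`: `G_{o,q} = (∂P_o/∂F_q)(γ)`. -/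
def gradMatrix {T : ℕ} (γ : Fin n × Fin n → ℂ) (P : Fin T → MvPolynomial (Fin n × Fin n) ℂ) :
    Matrix (Fin T) (Fin n × Fin n) ℂ :=
  Matrix.of fun o q => eval γ (pderiv q (P o))

/-! ## The coefficient identity for `P(ψ_γ)` -/

/-- `coeff_0 (P(ψ_γ)) = P(γ)`. -/
theorem constantCoeff_aeval_psi (γ : Fin n × Fin n → ℂ) (P : MvPolynomial (Fin n × Fin n) ℂ) :
    constantCoeff (aeval (psi γ) P) = eval γ P := by
  induction P using MvPolynomial.induction_on with
  | C a => simp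
  | add p q hp hq => simp only [map_add, hp, hq]
  | mul_X p q h =>
    rw [map_mul, map_mul, aeval_X, map_mul, eval_X, h]
    congr 1
    simp [psi]

/-- `coeff_{a_A b_B}(Q · a_a b_b) = [a = A ∧ b = B] · coeff_0 Q`. -/
theorem coeff_ab_mul_X_mul_X (Q : MvPolynomial (GraphVars n) ℂ) (A a B b : Fin n × Fin n) :
    coeff (Finsupp.single (Sum.inl (Sum.inl A) : GraphVars n) 1 +
        Finsupp.single (Sum.inl (Sum.inr B) : GraphVars n) 1)
      (Q * (X (Sum.inl (Sum.inl a)) * X (Sum.inl (Sum.inr b)))) =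
    if a = A ∧ b = B then coeff 0 Q else 0 := by
  classical
  have hX : (X (Sum.inl (Sum.inl a)) * X (Sum.inl (Sum.inr b)) : MvPolynomial (GraphVars n) ℂ) =
      monomial (Finsupp.single (Sum.inl (Sum.inl a) : GraphVars n) 1 +
        Finsupp.single (Sum.inl (Sum.inr b) : GraphVars n) 1) 1 := by
    rw [X, X, monomial_mul, mul_one]
  rw [hX, coeff_mul_monomial', mul_one]
  by_cases hab : a = A ∧ b = B
  · obtain ⟨rfl, rfl⟩ := hab
    simp
  · rw [if_neg hab, if_neg]
    intro hle
    apply hab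
    rw [Finsupp.le_def] at hle
    constructor
    · have h1 := hle (Sum.inl (Sum.inl a))
      by_contra hne
      have hne' : (Sum.inl (Sum.inl A) : GraphVars n) ≠ Sum.inl (Sum.inl a) := by
        simpa using fun h => hne h.symm
      simp [hne'] at h1
    · have h2 := hle (Sum.inl (Sum.inr b))
      by_contra hne
      have hne' : (Sum.inl (Sum.inr B) : GraphVars n) ≠ Sum.inl (Sum.inr b) := by
        simpa using fun h => hne h.symm
      simp [hne'] at h2

/-- **Coefficient identity for `P(ψ_γ)`.**  For every `P ∈ ℂ[F]`, `γ`, and `i j j' l`: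
`coeff_{a_ij b_j'l}(P(ψ_γ)) = −[j = j'] · (∂P/∂F_il)(γ)`.  (Each factor `ψ_γ(F_q) = γ_q − (ab)_q`
contributes either the constant `γ_q` or one `ab`-term; a bilinear monomial takes exactly one
`ab`-term.) -/
theorem coeff_ab_aeval_psi (γ : Fin n × Fin n → ℂ) (P : MvPolynomial (Fin n × Fin n) ℂ)
    (i j j' l : Fin n) :
    coeff (Finsupp.single (Sum.inl (Sum.inl (i, j)) : GraphVars n) 1 +
        Finsupp.single (Sum.inl (Sum.inr (j', l)) : GraphVars n) 1) (aeval (psi γ) P) =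
      -(if j = j' then eval γ (pderiv (i, l) P) else 0) := by
  classical
  induction P using MvPolynomial.induction_on with
  | C a =>
    rw [aeval_C, pderiv_C]
    simp only [algebraMap_eq, coeff_C, map_zero, ite_self, neg_zero]
    rw [if_neg]
    intro h
    have := congrArg (fun d => d (Sum.inl (Sum.inl (i, j)))) h
    simp at this
  | add p q hp hq =>
    simp only [map_add, coeff_add, hp, hq]
    split_ifs <;> ring
  | mul_X p q h =>
    rw [map_mul, aeval_X]
    set Q := aeval (psi γ) p with hQ
    have hQ0 : coeff 0 Q = eval γ p := by
      rw [← constantCoeff_eq, hQ, constantCoeff_aeval_psi]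
    have hsplit : Q * psi γ q = C (γ q) * Q -
        ∑ k : Fin n, Q * (X (Sum.inl (Sum.inl (q.1, k))) * X (Sum.inl (Sum.inr (k, q.2)))) := by
      rw [psi, mul_sub, Finset.mul_sum, mul_comm Q (C _)]
    have hsum : (∑ k : Fin n, coeff (Finsupp.single (Sum.inl (Sum.inl (i, j)) : GraphVars n) 1 +
          Finsupp.single (Sum.inl (Sum.inr (j', l)) : GraphVars n) 1)
        (Q * (X (Sum.inl (Sum.inl (q.1, k))) * X (Sum.inl (Sum.inr (k, q.2)))))) =
        if j = j' ∧ q = (i, l) then eval γ p else 0 := by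
      simp_rw [coeff_ab_mul_X_mul_X, hQ0]
      rw [Finset.sum_eq_single j]
      · have hiff : ((q.1, j) = (i, j) ∧ (j, q.2) = (j', l)) ↔ (j = j' ∧ q = (i, l)) := by
          constructor
          · rintro ⟨h1, h2⟩
            exact ⟨(Prod.mk.inj h2).1, Prod.ext (Prod.mk.inj h1).1 (Prod.mk.inj h2).2⟩
          · rintro ⟨rfl, rfl⟩; exact ⟨rfl, rfl⟩
        by_cases hc : j = j' ∧ q = (i, l)
        · rw [if_pos hc, if_pos (hiff.2 hc)]
        · rw [if_neg hc, if_neg fun h' => hc (hiff.1 h')]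
      · intro k _ hk
        rw [if_neg]
        rintro ⟨h1, -⟩
        exact hk (Prod.mk.inj h1).2
      · intro hj; exact absurd (Finset.mem_univ j) hj
    have hderiv : eval γ (pderiv (i, l) (p * X q)) =
        eval γ (pderiv (i, l) p) * γ q + (if q = (i, l) then eval γ p else 0) := by
      rw [pderiv_mul, map_add, map_mul, map_mul, eval_X]
      by_cases hq : q = (i, l)
      · subst hq; rw [pderiv_X_self, map_one, if_pos rfl, mul_one]
      · rw [pderiv_X_of_ne hq, map_zero, if_neg hq, mul_zero]
    rw [hsplit, coeff_sub, coeff_C_mul, h, coeff_sum, hsum, hderiv]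
    by_cases hjj : j = j' <;> by_cases hq : q = (i, l) <;> simp [hjj, hq] <;> ring

/-! ## The system-free core: initial forms in the generators force fast multiplication -/

/-- **Initial-form cost–rank inequality (system-free core).**  Let `p_o` (`o < T`) lie in the
cost-free span of one nonscalar sequence of length `≤ N`; let `m_o ≤ K` and
`P_o ∈ ℂ[F_q : q ∈ n×n]` with `(p_o)_{m_o} = P_o(f)` (weighted component for `w(a)=w(b)=1`,
`w(c)=2`; `f` the generators); and let the gradient matrix `(∂P_o/∂F_q)(γ)` have rank `n²` for
some `γ`.  Then `R(⟨n,n,n⟩) ≤ 2·(K·K·N)`. -/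
theorem tensorRank_le_of_initialForms {n T N K : ℕ}
    (p : Fin T → MvPolynomial (GraphVars n) ℂ)
    (hspan : ∃ gs : List (MvPolynomial (GraphVars n) ℂ), IsNonscalarSeq gs ∧ gs.length ≤ N ∧
      ∀ o, p o ∈ freeSpan {q | q ∈ gs})
    (m : Fin T → ℕ) (hm : ∀ o, m o ≤ K)
    (P : Fin T → MvPolynomial (Fin n × Fin n) ℂ)
    (hinit : ∀ o, weightedHomogeneousComponent (gw n) (m o) (p o) = aeval (generator n) (P o))
    (γ : Fin n × Fin n → ℂ) (hrank : (gradMatrix γ P).rank = n * n) :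
    tensorRank (matMulTensor ℂ n n n) ≤ 2 * (K * K * N) := by
  classical
  -- Step 1: the initial forms are cheap (weighted truncation)
  obtain ⟨gs', hns', hlen', hmem'⟩ :=
    exists_weightedTruncation_of_span (gw n) gw_ne_zero K p m hm hspan
  -- Step 2: substitute `c ↦ γ` (free, BCS §4.1 Rem. (4.3))
  obtain ⟨hns'', hmem''⟩ :=
    IsNonscalarSeq.aeval_append (θ := constC γ) (hs := []) (constC_mem_freeSpan γ)
      isNonscalarSeq_nil hns'
  have hr : ∀ o, aeval (constC γ) (weightedHomogeneousComponent (gw n) (m o) (p o)) =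
      aeval (psi γ) (P o) := by
    intro o; rw [hinit, aeval_constC_aeval_generator]
  -- Step 3: BCS (14.1): the bilinear `A ⊗ B`-coefficients form a tensor of rank `≤ 2·K·K·N`
  obtain ⟨r, hr2, w, u, v, hwuv⟩ := exists_triads_of_isNonscalarSeq
    (fun a : Fin n × Fin n => (Sum.inl (Sum.inl a) : GraphVars n))
    (fun b : Fin n × Fin n => (Sum.inl (Sum.inr b) : GraphVars n))
    (fun a b hab => by simp at hab) (fun o => aeval (psi γ) (P o))
    ⟨gs'.map (aeval (constC γ)) ++ [], hns'', by simpa using hlen', fun o => by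
      rw [← hr o]; exact hmem'' _ (hmem' o)⟩
  -- Step 4: a left inverse of the gradient matrix recovers `⟨n,n,n⟩`
  obtain ⟨Pm, hPJ⟩ := leftInverse_of_rank_eq (gradMatrix γ P) hrank
  refine le_trans (tensorRank_le_of_eq_sum (fun ρ c => -∑ o, Pm c o * w ρ o) u v ?_) hr2
  funext c a b
  obtain ⟨i, j⟩ := a
  obtain ⟨j', l⟩ := b
  have key : ∀ o, ∑ ρ, w ρ o * u ρ (i, j) * v ρ (j', l) =
      -(if j = j' then gradMatrix γ P o (i, l) else 0) := by
    intro o; rw [hwuv, coeff_ab_aeval_psi]; rfl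
  have hPJ' : ∀ q, ∑ o, Pm c o * gradMatrix γ P o q = if c = q then 1 else 0 := by
    intro q
    have := congrFun (congrFun hPJ c) q
    simpa [Matrix.mul_apply, Matrix.one_apply] using this
  have hsum : ∑ ρ, (-∑ o, Pm c o * w ρ o) * u ρ (i, j) * v ρ (j', l) =
      -∑ o, Pm c o * ∑ ρ, w ρ o * u ρ (i, j) * v ρ (j', l) := by
    simp only [neg_mul, Finset.sum_neg_distrib, Finset.sum_mul, Finset.mul_sum]
    rw [Finset.sum_comm]
    congr 1
    refine Finset.sum_congr rfl fun o _ => Finset.sum_congr rfl fun ρ _ => by ring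
  simp only [Finset.sum_apply, triad_apply]
  rw [hsum]
  simp_rw [key]
  by_cases hjj : j = j'
  · subst hjj
    simp only [if_true, mul_neg, Finset.sum_neg_distrib, neg_neg, hPJ']
    obtain ⟨c1, c2⟩ := c
    simp [matMulTensor, Prod.ext_iff]
  · simp [matMulTensor, hjj]

/-! ## Equation systems: initial-form nondegeneracy at a point of the graph -/

namespace EqSystem

/-- **INITIAL-FORM NONDEGENERATE to order `K` at `x`.**  After the free shift `θ_x`, the weighted
components of orders `m_o ≤ K` of the tests are polynomials `P_o(f)` in the generators whose
gradient matrix has full rank `n²` at some `γ`.  (`ReducedAt x` is the case `K = 2`, `P_o` linear,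
`G = J_C(x)`.) -/
def InitNondegAt (E : EqSystem n) (K : ℕ) (x : GraphVars n → ℂ) : Prop :=
  ∃ (m : Fin E.tests.length → ℕ) (P : Fin E.tests.length → MvPolynomial (Fin n × Fin n) ℂ)
    (γ : Fin n × Fin n → ℂ),
    (∀ o, m o ≤ K) ∧
    (∀ o, weightedHomogeneousComponent (gw n) (m o)
        (bind₁ (shift x) (E.testPoly (E.tests.get o))) = aeval (generator n) (P o)) ∧
    (gradMatrix γ P).rank = n * n

/-- Initial-form nondegenerate to order `K` at SOME point of the graph. -/
def InitNondeg (E : EqSystem n) (K : ℕ) : Prop := ∃ x ∈ mmGraph n, E.InitNondegAt K x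

end EqSystem

/-- **Initial-form cost–rank inequality for equation systems**: a fan-in-two system which is
initial-form nondegenerate to order `K` at some point has `R(⟨n,n,n⟩) ≤ 2·K²·cost`. -/
theorem tensorRank_le_of_initNondegAt {E : EqSystem n} (hE : E.circuit.IsFanInTwo) {K : ℕ}
    {x : GraphVars n → ℂ} (h : E.InitNondegAt K x) :
    tensorRank (matMulTensor ℂ n n n) ≤ 2 * (K * K * E.cost) := by
  obtain ⟨m, P, γ, hm, hinit, hrank⟩ := h
  obtain ⟨gs, hns, hlen, hmem⟩ := exists_isNonscalarSeq_tests E hE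
  -- the shift `θ_x` is free (BCS §4.1 Rem. (4.3))
  obtain ⟨hns', hmem'⟩ :=
    IsNonscalarSeq.aeval_append (θ := shift x) (hs := []) (shift_mem_freeSpan x)
      isNonscalarSeq_nil hns
  refine tensorRank_le_of_initialForms
    (fun o => bind₁ (shift x) (E.testPoly (E.tests.get o)))
    ⟨gs.map (aeval (shift x)) ++ [], hns', by simpa using hlen, fun o => ?_⟩ m hm P hinit γ hrank
  rw [← aeval_eq_bind₁]
  exact hmem' _ (hmem o)

/-! ## The piece `H_init` and `H_init → H_mult` -/

/-- `EqAdmissibleInit β`: correct equation systems for `W_n` of cost `O(n^β)`, initial-form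
nondegenerate to a bounded order at some point of the graph, exist for all `n ≥ 1`. -/
def EqAdmissibleInit (β : ℝ) : Prop :=
  ∃ (K : ℕ) (c : ℝ), ∀ n : ℕ, 1 ≤ n → ∃ E : EqSystem n, E.Correct ∧ E.InitNondeg K ∧
    (E.cost : ℝ) ≤ c * (n : ℝ) ^ β

/-- **`EqAdmissibleInit β → ω ≤ β`** (`R(⟨n,n,n⟩) ≤ 2K²·cost = O(n^β)`). -/
theorem omega_le_of_eqAdmissibleInit {β : ℝ} (h : EqAdmissibleInit β) : omega ℂ ≤ β := by
  obtain ⟨K, c, hc⟩ := h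
  have hmem : β ∈ admissibleExponents ℂ := by
    change (fun n : ℕ => (tensorRank (matMulTensor ℂ n n n) : ℝ)) =O[Filter.atTop]
      fun n : ℕ => (n : ℝ) ^ β
    refine Asymptotics.IsBigO.of_bound (2 * ((K : ℝ) * K) * |c|) ?_
    filter_upwards [Filter.eventually_ge_atTop 1] with n hn
    obtain ⟨E, hE, ⟨x, -, hx⟩, hcost⟩ := hc n hn
    have h1 := tensorRank_le_of_initNondegAt hE.1 hx
    rw [Real.norm_of_nonneg (Nat.cast_nonneg _),
      Real.norm_of_nonneg (Real.rpow_nonneg (Nat.cast_nonneg _) _)]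
    have h3 : (tensorRank (matMulTensor ℂ n n n) : ℝ) ≤ 2 * ((K : ℝ) * K * (E.cost : ℝ)) := by
      exact_mod_cast h1
    have h4 : c * (n : ℝ) ^ β ≤ |c| * (n : ℝ) ^ β := by
      gcongr; exact le_abs_self c
    have hK : (0 : ℝ) ≤ (K : ℝ) * K := by positivity
    nlinarith [h3, hcost, h4, hK, Real.rpow_nonneg (Nat.cast_nonneg n) β,
      mul_nonneg hK (Real.rpow_nonneg (Nat.cast_nonneg n) β)]
  exact csInf_le (admissibleExponents_bddBelow ℂ) hmem

/-- **`H_init` — INITIAL-FORM REDUCTION (the weaker sufficient piece beneath `H_mult`).**  A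
correct system of cost `O(n^β)` can be replaced, for every `β' > β`, by a correct system of cost
`O(n^{β'})` which is initial-form nondegenerate to a bounded order at some point of the graph. -/
def InitialFormReduction : Prop :=
  ∀ β : ℝ, 2 ≤ β → EqAdmissible β → ∀ β' : ℝ, β < β' → EqAdmissibleInit β'

/-- **`H_init → H_mult`** (midpoint exponent; `ω ≤ β'' < β'` gives reduced systems at `β'`). -/
theorem multiplicityReduction_of_initialFormReduction (h : InitialFormReduction) :
    MultiplicityReduction := by
  intro β hβ hE β' hβ'
  have hinit : EqAdmissibleInit ((β + β') / 2) := h β hβ hE _ (by linarith)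
  have hω : omega ℂ ≤ (β + β') / 2 := omega_le_of_eqAdmissibleInit hinit
  exact eqAdmissibleRed_of_omega_lt (lt_of_le_of_lt hω (by linarith))

/-- `H_init → H` (with the landed reduced branch). -/
theorem equationsForceMultiplication_of_initialFormReduction (h : InitialFormReduction) :
    EquationsForceMultiplication := by
  intro β hβ hE
  refine le_of_forall_gt_imp_ge_of_dense fun β' hβ' => ?_
  exact omega_le_of_eqAdmissibleInit (h β hβ hE β' hβ')

/-- **The route modulo `V` and `H_init`:** `V → H_init → S`. -/
theorem matrixMultiplication_of_quadratic_of_initialFormReduction (hV : GraphEquationsQuadratic)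
    (h : InitialFormReduction) : _root_.MatrixMultiplication :=
  closes hV (equationsForceMultiplication_of_initialFormReduction h)

end Summit.MatrixMultiplication.MatrixMultiplication.Theorems.GraphEquations

end
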